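import Literature.Probability.RandomPlanarGeometry.LoewnerRegularBoxes
import Literature.Probability.RandomPlanarGeometry.SelfAvoidingWalk
import Summits.CriticalPhenomena.SAWScalingLimit.Theorems.SimpleSubseqLimits.Negative.SimpleSubseqLimitsHonesty
import HarnessLib

/-!
# Describability of subsequential SAW limits from KS regularity — stub
`stub_describable_of_ksRegular` of the line `capacity-clock-no-plateau`
(crux `SAWLoopFugacityFlow.SimpleSubseqLimits`, stmt-CriticalPhenomena-4982)

The ORDER half of the line in Kemppainen–Smirnov's form, read along a sequence of meshes: if along
every honest sequence of meshes `s n → 0⁺` (all SAW laws probability measures) the critical SAW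
laws of `(D; a_{s n}, b_{s n})` are KS-regular through approximating Dobrushin domains `D_n` and
chordal uniformizing maps `φ_n → φ` (`SAWKSRegularAlong`: (U1) on the compacts
`{0 ≤ im} ∩ closedBall 0 R` of the closed half-plane, (U2) at infinity, `b_n → b`, and for every
`ε > 0` ONE regularity class `regularCurves (φ_n) 𝔯` of mass `≥ 1 - ε` for all `n`), then every
subsequential weak limit `ν` of the laws along any `s n → 0⁺` is `ν`-a.e. described by the Loewner
evolution through `φ`.

Proof. (1) Honesty: the weak limit being a probability measure, the SAW laws at mesh `s n` are
probability measures for `n ≥ N₀` (`Negative.eventually_isProbabilityMeasure_of_weakLimitAlong`,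
test function `1`); the tail `s' = s (· + N₀) → 0⁺` is honest and has the same weak limit, so the
hypothesis supplies `D_n`, `φ_n` and the regularity classes along `s'`. (2) KS Thm. 1.5 (ii) with
Cor. 1.7–1.8 in the event form for approximating domains, here in the variant
`ae_isLoewnerDescribable_of_eventually_regular` stated for random curve classes `Y n` under laws
`P n` with the regularity bound in PREIMAGE form `P n (Y n ⁻¹' (regularCurves (φ_n) 𝔯)ᶜ) ≤ ε`
(which is literally the clause of `SAWKSRegularAlong`, so that no measurability of the classes
`regularCurves` in the curve space is needed) and required only EVENTUALLY in `n`. Its proof is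
that of the tree's `ae_isLoewnerDescribable_and_tendstoInDistribution_of_regularCurves_varying`:
for each `ε`, ONE compact box of Loewner pairs (`exists_pairBox_of_regularCurves`, from the uniform
properness / smallness at infinity of the `Φ_n`, `exists_forall_le_dist_boundaryExtension_of_varying`,
`exists_forall_dist_boundaryExtension_lt_of_varying`) whose closed images
`K n = ⟦Φ_n ∘ pr₁⟧ '' box ⊇ regularCurves (φ_n) 𝔯` (`isClosed_image_and_continuousOn_drivingPath`)
carry `P n`-mass `≥ 1 - ε` eventually, support transfer along varying good sets
(`Process.ae_mem_of_tendstoInDistribution_of_forall_exists_seq_limits`), and describability of the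
limits of good sequences (`tendsto_snd_of_good_sequence`).

The predicates `IsSubseqLimit` and `SAWKSRegularAlong` are VERBATIM copies of the skeleton's
vocabulary (`Cruxes/SimpleSubseqLimits/Lines/capacity-clock-no-plateau.lean`), kept in the
sub-namespace `…CapacityClock.Describable`; they agree with the skeleton's copies by `Iff.rfl`.
-/

noncomputable section

open MeasureTheory Filter Topology Set Metric
open Literature.Probability.RandomPlanarGeometry Literature.Probability.LatticeModels
open UpperHalfPlane (upperHalfPlaneSet)
open scoped ENNReal NNReal BoundedContinuousFunction unitInterval

namespace Summit.CriticalPhenomena.SAWScalingLimit.Theorems.SimpleSubseqLimits.CapacityClock.Describable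

/-- `ν` is a probability measure on curve classes that is the weak limit, along `s n → 0⁺`, of the
pushed-forward critical `δℤ²` SAW laws of `(D; a_δ, b_δ)` — the three antecedents of the crux,
verbatim (copy of the skeleton's definition, line `capacity-clock-no-plateau` of crux
stmt-CriticalPhenomena-4982). [folklore] -/
def IsSubseqLimit (D : DobrushinDomain) (a b : ℝ → Site 2) (s : ℕ → ℝ)
    (ν : Measure (CurveClass ℂ)) : Prop :=
  Tendsto s atTop (𝓝[>] (0 : ℝ)) ∧ IsProbabilityMeasure ν ∧
    ∀ f : BoundedContinuousFunction (CurveClass ℂ) ℝ,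
      Tendsto (fun n => ∫ γ, f γ.curve ∂(SAW.law D.carrier (s n) (a (s n)) (b (s n)))) atTop
        (𝓝 (∫ x, f x ∂ν))

/-- **KS regularity of the critical SAW along a sequence of meshes, through approximating maps**
(ALL indices): approximating Dobrushin domains `D_n` with chordal uniformizing maps `φ_n` whose
boundary extensions converge to that of `φ` uniformly on the compacts `{0 ≤ im} ∩ closedBall 0 R`
((U1)) and uniformly at infinity ((U2)), `b_n → b`, and for every `ε > 0` ONE regularity `𝔯`
(KS's event `E ∩ X_simple`, `LoewnerRegularCurves.lean`) with
`P_{s n}[curve ∉ regularCurves (φ_n) 𝔯] ≤ ε` for ALL `n` (copy of the skeleton's definition, line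
`capacity-clock-no-plateau` of crux stmt-CriticalPhenomena-4982).
[cite: KemppainenSmirnov2017, Thm. 1.5, Cor. 1.7, Cor. 1.8 and §3.5] -/
def SAWKSRegularAlong (D : DobrushinDomain) (a b : ℝ → Site 2)
    (φ : ConformalEquiv upperHalfPlaneSet D.carrier) (s : ℕ → ℝ) : Prop :=
  ∃ (Ds : ℕ → DobrushinDomain) (φs : ∀ n, ConformalEquiv upperHalfPlaneSet (Ds n).carrier),
    (∀ n, (Ds n).IsChordalUniformizing (φs n)) ∧
    (∀ R : ℝ, TendstoUniformlyOn (fun n => (φs n).boundaryExtension) φ.boundaryExtension atTop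
      ({z : ℂ | 0 ≤ z.im} ∩ Metric.closedBall 0 R)) ∧
    (∀ ε : ℝ, 0 < ε → ∃ r : ℝ, ∀ᶠ n in atTop, ∀ z : ℂ, z ∈ {z : ℂ | 0 ≤ z.im} → r ≤ ‖z‖ →
      dist ((φs n).boundaryExtension z) ((Ds n).pt 1) ≤ ε) ∧
    Tendsto (fun n => (Ds n).pt 1) atTop (𝓝 (D.pt 1)) ∧
    ∀ ε : ℝ≥0∞, 0 < ε → ∃ 𝔯 : LoewnerRegularity, ∀ n,
      SAW.law D.carrier (s n) (a (s n)) (b (s n)) {γ | γ.curve ∈ (regularCurves (φs n) 𝔯)ᶜ} ≤ ε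

/-- **Kemppainen–Smirnov's Thm. 1.5 (ii) with Cor. 1.7–1.8, event form, approximating domains,
EVENTUAL regularity, for random curve classes.** Let `(D_n; a_n, b_n) → (D; a, b)` be Dobrushin
domains with chordal uniformizing maps `φ_n`, `φ` whose boundary extensions converge uniformly on
the compacts `{0 ≤ im} ∩ closedBall 0 R` ((U1)) and uniformly at infinity ((U2)), with `b_n → b`;
let `Y n` be random curve classes under probability laws `P n` converging in law to the
probability measure `ν`. If for every `ε > 0` some regularity class `regularCurves (φ_n) 𝔯` has
`P n`-mass `≥ 1 - ε` for all LARGE `n`, then `ν`-a.e. curve class is described by the Loewner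
evolution through `φ`. (The tree's `ae_isLoewnerDescribable_and_tendstoInDistribution_of_regularCurves_varying`
with "for all `n`" weakened to "eventually", which is what its proof uses: one compact box per `ε`
by `exists_pairBox_of_regularCurves`, closed images `⟦Φ_n ∘ pr₁⟧ '' box`, support transfer along
varying good sets, and `tendsto_snd_of_good_sequence`.)
[cite: KemppainenSmirnov2017, Thm. 1.5, Cor. 1.7, Cor. 1.8, §3.5] -/
theorem ae_isLoewnerDescribable_of_eventually_regular
    {D : DobrushinDomain} {φ : ConformalEquiv upperHalfPlaneSet D.carrier}
    {Ds : ℕ → DobrushinDomain} {φs : ∀ n, ConformalEquiv upperHalfPlaneSet (Ds n).carrier}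
    (hφ : D.IsChordalUniformizing φ) (hφs : ∀ n, (Ds n).IsChordalUniformizing (φs n))
    (hU1 : ∀ R : ℝ, TendstoUniformlyOn (fun n ↦ (φs n).boundaryExtension) φ.boundaryExtension
      atTop ({z : ℂ | 0 ≤ z.im} ∩ closedBall 0 R))
    (hU2 : ∀ ε : ℝ, 0 < ε → ∃ r : ℝ, ∀ᶠ n in atTop, ∀ z : ℂ, z ∈ {z : ℂ | 0 ≤ z.im} → r ≤ ‖z‖ →
      dist ((φs n).boundaryExtension z) ((Ds n).pt 1) ≤ ε)
    (hb : Tendsto (fun n ↦ (Ds n).pt 1) atTop (𝓝 (D.pt 1)))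
    {Ω : ℕ → Type*} [∀ n, MeasurableSpace (Ω n)] {Y : ∀ n, Ω n → CurveClass ℂ}
    {P : ∀ n, Measure (Ω n)} [∀ n, IsProbabilityMeasure (P n)]
    (hY : ∀ n, AEMeasurable (Y n) (P n))
    {ν : Measure (CurveClass ℂ)} [IsProbabilityMeasure ν]
    (hlim : ∀ f : CurveClass ℂ →ᵇ ℝ,
      Tendsto (fun n ↦ ∫ ω, f (Y n ω) ∂P n) atTop (𝓝 (∫ c, f c ∂ν)))
    (h : ∀ ε : ℝ≥0∞, 0 < ε → ∃ 𝔯 : LoewnerRegularity, ∀ᶠ n in atTop,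
      P n ((Y n) ⁻¹' (regularCurves (φs n) 𝔯)ᶜ) ≤ ε) :
    ∀ᵐ c ∂ν, IsLoewnerDescribable φ c := by
  -- the laws of the `Y n` converge weakly to `ν`
  set μs : ℕ → Measure (CurveClass ℂ) := fun n ↦ (P n).map (Y n) with hμsdef
  haveI hμs : ∀ n, IsProbabilityMeasure (μs n) := fun n ↦ Measure.isProbabilityMeasure_map (hY n)
  have hlim' : ∀ f : CurveClass ℂ →ᵇ ℝ,
      Tendsto (fun n ↦ ∫ c, f c ∂μs n) atTop (𝓝 (∫ c, f c ∂ν)) := by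
    intro f
    have hint : (fun n ↦ ∫ c, f c ∂μs n) = fun n ↦ ∫ ω, f (Y n ω) ∂P n :=
      funext fun n ↦ integral_map (hY n) f.continuous.aestronglyMeasurable
    rw [hint]
    exact hlim f
  have hid := tendstoInDistribution_id_of_forall_integral_tendsto hlim'
  -- uniform smallness at infinity and uniform properness of the `Φ_n`
  have hinf := fun ρ (hρ : (0 : ℝ) < ρ) ↦
    exists_forall_dist_boundaryExtension_lt_of_varying hφs hU2 hρ
  have hprop := exists_forall_le_dist_boundaryExtension_of_varying hφ hφs hU1 hb
  refine Literature.Probability.Process.ae_mem_of_tendstoInDistribution_of_forall_exists_seq_limits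
    (G := {c | IsLoewnerDescribable φ c}) hid fun ε hε ↦ ?_
  obtain ⟨𝔯, h𝔯⟩ := h ε hε
  obtain ⟨δγ, δW, T, hδγ, hδW, hbox⟩ := exists_pairBox_of_regularCurves hφs hinf hprop 𝔯
  set 𝒦 : Set (C(ℝ≥0, ℂ) × C(ℝ≥0, ℝ)) := {p | p ∈ generatedPairs ∧
    p.1 ∈ Literature.Probability.Process.modulusSet ({0} : Set ℂ) δγ ∧
    p.2 ∈ Literature.Probability.Process.modulusSet ({0} : Set ℝ) δW ∧
    ∀ (k : ℕ) (t : ℝ≥0), T k ≤ t → (k : ℝ) ≤ ‖p.1 t‖} with h𝒦def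
  have h𝒦 : IsCompact 𝒦 := isCompact_pairBox hδγ hδW T
  have hgen : 𝒦 ⊆ generatedPairs := fun p hp ↦ hp.1
  have htrans : ∀ r : ℝ, ∃ T' : ℝ≥0, ∀ p ∈ 𝒦, ∀ t, T' ≤ t → r ≤ ‖p.1 t‖ := fun r ↦
    ⟨T ⌈r⌉₊, fun p hp t ht ↦ (Nat.le_ceil r).trans (hp.2.2.2 _ t ht)⟩
  set K : ℕ → Set (CurveClass ℂ) := fun n ↦
    (fun p ↦ compactifiedClass (φs n).boundaryExtension ((Ds n).pt 1) p.1) '' 𝒦 with hKdef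
  have hKm : ∀ n, MeasurableSet (K n) := fun n ↦
    (isClosed_image_and_continuousOn_drivingPath (hφs n) h𝒦 hgen htrans).2.2.1.measurableSet
  refine ⟨K, hKm, ?_, ?_⟩
  · filter_upwards [h𝔯] with n hn
    calc μs n ((fun c : CurveClass ℂ ↦ c) ⁻¹' (K n)ᶜ) = P n ((Y n) ⁻¹' (K n)ᶜ) :=
          Measure.map_apply_of_aemeasurable (hY n) (hKm n).compl
      _ ≤ P n ((Y n) ⁻¹' (regularCurves (φs n) 𝔯)ᶜ) :=
          measure_mono (preimage_mono (compl_subset_compl.2 (hbox n)))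
      _ ≤ ε := hn
  · rintro x ⟨u, hu, xs, hxs, hxlim⟩
    choose ps hps hpx using hxs
    have hx' : Tendsto (fun j ↦ compactifiedClass (φs (u j)).boundaryExtension ((Ds (u j)).pt 1)
        (ps j).1) atTop (𝓝 x) := by
      simpa only [hpx] using hxlim
    exact (tendsto_snd_of_good_sequence hφ hφs hU1 hU2 hb h𝒦 hgen htrans
      hu.tendsto_atTop hps hx').2.1

/-- **STUB 3a of the line `capacity-clock-no-plateau` — describability from KS regularity.** If
along every honest sequence of meshes the critical SAW laws of `(D; a_δ, b_δ)` are KS-regular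
through approximating maps converging to the chordal uniformizing map `φ` (`SAWKSRegularAlong`),
then every subsequential weak limit `ν` along `s n → 0⁺` is `ν`-a.e. described by the Loewner
evolution through `φ` — the deterministic half of Kemppainen–Smirnov's Thm. 1.5 (ii) read along the
sequence: the laws are honest for `n ≥ N₀` (`Negative.eventually_isProbabilityMeasure_of_weakLimitAlong`),
the tail `n ↦ s (n + N₀)` has the same weak limit, the hypothesis is applied to the tail, and
`ae_isLoewnerDescribable_of_eventually_regular` concludes (the clause
`{γ | γ.curve ∈ (regularCurves (φ_n) 𝔯)ᶜ}` of `SAWKSRegularAlong` IS the preimage form). The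
endpoint approximation hypothesis is idle (kept for the registered signature).
[cite: KemppainenSmirnov2017, Thm. 1.5, Cor. 1.7, Cor. 1.8] -/
theorem stub_describable_of_ksRegular :
    ∀ (D : DobrushinDomain) (a b : ℝ → Site 2), SAW.IsEndpointApprox D a b →
      ∀ (φ : ConformalEquiv upperHalfPlaneSet D.carrier), D.IsChordalUniformizing φ →
        (∀ s : ℕ → ℝ, Tendsto s atTop (𝓝[>] (0 : ℝ)) →
          (∀ n, IsProbabilityMeasure (SAW.law D.carrier (s n) (a (s n)) (b (s n)))) →
          SAWKSRegularAlong D a b φ s) →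
        ∀ (s : ℕ → ℝ) (ν : Measure (CurveClass ℂ)), IsSubseqLimit D a b s ν →
          ∀ᵐ c ∂ν, IsLoewnerDescribable φ c := by
  intro D a b _hab φ hφ hKS s ν hsub
  obtain ⟨hs, hν, hw⟩ := hsub
  haveI := hν
  -- (1) honesty of the laws along a tail of the sequence
  obtain ⟨N₀, hN₀⟩ := eventually_atTop.1
    (Negative.eventually_isProbabilityMeasure_of_weakLimitAlong (D := D) (a := a) (b := b)
      (s := s) (ν := ν) hw)
  have hT := tendsto_add_atTop_nat N₀
  have hs' : Tendsto (fun n ↦ s (n + N₀)) atTop (𝓝[>] (0 : ℝ)) := hs.comp hT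
  haveI hP : ∀ n, IsProbabilityMeasure
      (SAW.law D.carrier (s (n + N₀)) (a (s (n + N₀))) (b (s (n + N₀)))) :=
    fun n ↦ (hN₀ (n + N₀) (Nat.le_add_left N₀ n)).1
  -- (2) KS regularity along the honest tail
  obtain ⟨Ds, φs, hφs, hU1, hU2, hb, hreg⟩ := hKS (fun n ↦ s (n + N₀)) hs' hP
  -- (3) the eventual form of KS Thm. 1.5 (ii) along the tail
  refine ae_isLoewnerDescribable_of_eventually_regular
    (Ω := fun n ↦ SAW.DomainSAW D.carrier (s (n + N₀)) (a (s (n + N₀))) (b (s (n + N₀))))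
    (Y := fun n γ ↦ γ.curve)
    (P := fun n ↦ SAW.law D.carrier (s (n + N₀)) (a (s (n + N₀))) (b (s (n + N₀))))
    hφ hφs hU1 hU2 hb (fun n ↦ SAW.aemeasurable_curve _ _ _ _) (fun f ↦ (hw f).comp hT)
    fun ε hε ↦ ?_
  obtain ⟨𝔯, h𝔯⟩ := hreg ε hε
  exact ⟨𝔯, Eventually.of_forall h𝔯⟩

end Summit.CriticalPhenomena.SAWScalingLimit.Theorems.SimpleSubseqLimits.CapacityClock.Describable

end
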